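import Literature.AlgebraicGeometry.Frobenioids.Categories
import Mathlib.CategoryTheory.Comma.Arrow
import Mathlib.CategoryTheory.Comma.Over.Basic
import Mathlib.CategoryTheory.MorphismProperty.Basic
import Mathlib.CategoryTheory.IsomorphismClasses
import Mathlib.CategoryTheory.Functor.FullyFaithful
import Mathlib.CategoryTheory.EssentialImage
import Mathlib.CategoryTheory.Equivalence
import HarnessLib

/-!
# Frobenioids I, §0: the category-theoretic dictionary, part 2 (STEP-0 calibration fragment)

Mochizuki, *The geometry of Frobenioids I: the general theory*, Kyushu J. Math. **62** (2008)
293–400, §0 "Notations and Conventions", paragraph **Categories**, kurims text pp. 17–18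
[cite: MochizukiFrdI2008, §0 pp.17-18]: abstract equivalences of arrows, the categorical fiber
product ("CFP") `C₁ ×_D C₂`, arrows minimal-adjoint / minimal-coadjoint / mid-adjoint to a class of
arrows, subordinate arrows, irreducible arrows, FSMI-morphisms, categories of FSMFF-type,
categorical quotients by groups of automorphisms, mono-minimal quotients, anchors, subanchors and
iso-subanchors; together with the claims printed there:

* if `Φ₂` is an equivalence then the projection `C₁ ×_D C₂ → C₁` is an equivalence (p. 17);
* a category of FSM-type contains no FSMI-morphisms (p. 17);
* a category of FSM-type is of FSMFF-type (p. 18);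
* no endomorphism of an object of a category of FSMFF-type is an FSMI-morphism (p. 18);
* in a totally epimorphic category an isomorphism is a mono-minimal categorical quotient of its
  domain by the trivial group (p. 18).

Dictionary with Mathlib: an abstract equivalence `f₁ ⇒ f₂` is an isomorphism `Arrow.mk f₁ ≅
Arrow.mk f₂` in the arrow category; a "collection of arrows" is a `MorphismProperty`; isomorphism
classes of objects of `^A C` are the quotient of `Under A` by `isIsomorphicSetoid`.
No statement of the paper is strengthened.
-/

namespace Literature.AlgebraicGeometry.Frobenioids

open CategoryTheory

universe v v₁ v₂ v₃ u u₁ u₂ u₃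

section Categories

variable {C : Type u} [Category.{v} C]

/-! ### Abstract equivalences; the categorical fiber product (p. 17) -/

/-- Arrows `f₁ : A₁ → B₁`, `f₂ : A₂ → B₂` are *abstractly equivalent* if there is a commutative
square with isomorphisms `A₁ ≅ A₂`, `B₁ ≅ B₂` as rows — an isomorphism in the arrow category
(FrdI §0 p. 17). [cite: MochizukiFrdI2008, §0 p.17] -/
def IsAbstractlyEquivalent {A₁ B₁ A₂ B₂ : C} (f₁ : A₁ ⟶ B₁) (f₂ : A₂ ⟶ B₂) : Prop :=
  Nonempty (Arrow.mk f₁ ≅ Arrow.mk f₂)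

/-- Abstract equivalence is reflexive. [cite: MochizukiFrdI2008, §0 p.17] -/
theorem IsAbstractlyEquivalent.refl {A B : C} (f : A ⟶ B) : IsAbstractlyEquivalent f f :=
  ⟨Iso.refl _⟩

/-- Abstract equivalence is symmetric. [cite: MochizukiFrdI2008, §0 p.17] -/
theorem IsAbstractlyEquivalent.symm {A₁ B₁ A₂ B₂ : C} {f₁ : A₁ ⟶ B₁} {f₂ : A₂ ⟶ B₂}
    (h : IsAbstractlyEquivalent f₁ f₂) : IsAbstractlyEquivalent f₂ f₁ :=
  ⟨h.some.symm⟩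

/-- Abstract equivalence is transitive. [cite: MochizukiFrdI2008, §0 p.17] -/
theorem IsAbstractlyEquivalent.trans {A₁ B₁ A₂ B₂ A₃ B₃ : C} {f₁ : A₁ ⟶ B₁} {f₂ : A₂ ⟶ B₂}
    {f₃ : A₃ ⟶ B₃} (h₁ : IsAbstractlyEquivalent f₁ f₂) (h₂ : IsAbstractlyEquivalent f₂ f₃) :
    IsAbstractlyEquivalent f₁ f₃ :=
  ⟨h₁.some ≪≫ h₂.some⟩

variable {C₁ : Type u₁} [Category.{v₁} C₁] {C₂ : Type u₂} [Category.{v₂} C₂]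
  {D : Type u₃} [Category.{v₃} D]

/-- The *categorical fiber product* ("CFP") `C₁ ×_D C₂` of functors `Φ₁ : C₁ → D`, `Φ₂ : C₂ → D`:
objects are triples `(A₁, A₂, α : Φ₁(A₁) ≅ Φ₂(A₂))` (FrdI §0 p. 17).
[cite: MochizukiFrdI2008, §0 p.17] -/
structure CFP (Φ₁ : C₁ ⥤ D) (Φ₂ : C₂ ⥤ D) : Type (max u₁ u₂ v₃) where
  /-- the `C₁`-component -/
  fst : C₁
  /-- the `C₂`-component -/
  snd : C₂
  /-- the identification `Φ₁(A₁) ≅ Φ₂(A₂)` -/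
  iso : Φ₁.obj fst ≅ Φ₂.obj snd

namespace CFP

variable {Φ₁ : C₁ ⥤ D} {Φ₂ : C₂ ⥤ D}

/-- Morphisms of the CFP: pairs `(γ₁, γ₂)` with `β ∘ Φ₁(γ₁) = Φ₂(γ₂) ∘ α` (FrdI §0 p. 17).
[cite: MochizukiFrdI2008, §0 p.17] -/
@[ext] structure Hom (X Y : CFP Φ₁ Φ₂) : Type (max v₁ v₂) where
  /-- the `C₁`-component -/
  fst : X.fst ⟶ Y.fst
  /-- the `C₂`-component -/
  snd : X.snd ⟶ Y.snd
  /-- compatibility with the identifications -/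
  w : Φ₁.map fst ≫ Y.iso.hom = X.iso.hom ≫ Φ₂.map snd

/-- The CFP is a category (FrdI §0 p. 17). [cite: MochizukiFrdI2008, §0 p.17] -/
instance instCategory : Category (CFP Φ₁ Φ₂) where
  Hom := Hom
  id X := ⟨𝟙 _, 𝟙 _, by simp⟩
  comp f g := ⟨f.fst ≫ g.fst, f.snd ≫ g.snd, by
    rw [Functor.map_comp, Category.assoc, g.w, ← Category.assoc, f.w, Category.assoc,
      Functor.map_comp]⟩
  id_comp f := by ext <;> exact Category.id_comp _
  comp_id f := by ext <;> exact Category.comp_id _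
  assoc f g h := by ext <;> exact Category.assoc _ _ _

/-- Extensionality for morphisms of the CFP. [cite: MochizukiFrdI2008, §0 p.17] -/
@[ext] theorem hom_ext {X Y : CFP Φ₁ Φ₂} {f g : X ⟶ Y} (h₁ : f.fst = g.fst) (h₂ : f.snd = g.snd) :
    f = g :=
  Hom.ext h₁ h₂

/-- Components of identities. [cite: MochizukiFrdI2008, §0 p.17] -/
@[simp] theorem id_fst (X : CFP Φ₁ Φ₂) : Hom.fst (𝟙 X) = 𝟙 X.fst := rfl

/-- Components of identities. [cite: MochizukiFrdI2008, §0 p.17] -/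
@[simp] theorem id_snd (X : CFP Φ₁ Φ₂) : Hom.snd (𝟙 X) = 𝟙 X.snd := rfl

/-- Components of composites. [cite: MochizukiFrdI2008, §0 p.17] -/
@[simp] theorem comp_fst {X Y Z : CFP Φ₁ Φ₂} (f : X ⟶ Y) (g : Y ⟶ Z) :
    (f ≫ g).fst = f.fst ≫ g.fst := rfl

/-- Components of composites. [cite: MochizukiFrdI2008, §0 p.17] -/
@[simp] theorem comp_snd {X Y Z : CFP Φ₁ Φ₂} (f : X ⟶ Y) (g : Y ⟶ Z) :
    (f ≫ g).snd = f.snd ≫ g.snd := rfl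

variable (Φ₁ Φ₂)

/-- The natural projection functor `C₁ ×_D C₂ → C₁` (FrdI §0 p. 17).
[cite: MochizukiFrdI2008, §0 p.17] -/
def proj₁ : CFP Φ₁ Φ₂ ⥤ C₁ where
  obj X := X.fst
  map f := f.fst

/-- The natural projection functor `C₁ ×_D C₂ → C₂`. [cite: MochizukiFrdI2008, §0 p.17] -/
def proj₂ : CFP Φ₁ Φ₂ ⥤ C₂ where
  obj X := X.snd
  map f := f.snd

/-- "One verifies easily that if `Φ₂` is an equivalence, then the natural projection functor
`C₁ ×_D C₂ → C₁` is also an equivalence" (FrdI §0 p. 17). [cite: MochizukiFrdI2008, §0 p.17] -/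
theorem isEquivalence_proj₁ [Φ₂.IsEquivalence] : (proj₁ Φ₁ Φ₂).IsEquivalence where
  faithful := ⟨fun {X Y} f g h => by
    have hw : X.iso.hom ≫ Φ₂.map f.snd = X.iso.hom ≫ Φ₂.map g.snd := by
      rw [← f.w, ← g.w]
      exact congrArg (fun k => Φ₁.map k ≫ Y.iso.hom) h
    exact hom_ext h (Φ₂.map_injective ((cancel_epi X.iso.hom).mp hw))⟩
  full := ⟨fun {X Y} γ₁ => ⟨⟨γ₁, Φ₂.preimage (X.iso.inv ≫ Φ₁.map γ₁ ≫ Y.iso.hom), by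
    rw [Functor.map_preimage, Iso.hom_inv_id_assoc]; rfl⟩, rfl⟩⟩
  essSurj := ⟨fun A₁ =>
    ⟨⟨A₁, Φ₂.objPreimage (Φ₁.obj A₁), (Φ₂.objObjPreimageIso (Φ₁.obj A₁)).symm⟩, ⟨Iso.refl _⟩⟩⟩

end CFP

/-! ### Factorisation vocabulary: minimal-adjoint, subordinate, irreducible, FSMI (p. 17) -/

/-- `φ` is *minimal-adjoint* to the class `S`: in every factorisation `φ = α ∘ β` with `β ∈ S`, the
arrow `β` is an isomorphism (FrdI §0 p. 17). [cite: MochizukiFrdI2008, §0 p.17] -/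
def IsMinimalAdjoint (S : MorphismProperty C) {A B : C} (φ : A ⟶ B) : Prop :=
  ∀ ⦃X : C⦄ (β : A ⟶ X) (α : X ⟶ B), β ≫ α = φ → S β → IsIso β

/-- `φ` is *minimal-coadjoint* to `S`: in every factorisation `φ = β ∘ α` with `β ∈ S`, `β` is an
isomorphism (FrdI §0 p. 17). [cite: MochizukiFrdI2008, §0 p.17] -/
def IsMinimalCoadjoint (S : MorphismProperty C) {A B : C} (φ : A ⟶ B) : Prop :=
  ∀ ⦃X : C⦄ (α : A ⟶ X) (β : X ⟶ B), α ≫ β = φ → S β → IsIso β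

/-- `φ` is *mid-adjoint* to `S`: in every factorisation `φ = α ∘ β ∘ γ` with `β ∈ S`, `β` is an
isomorphism (FrdI §0 p. 17). [cite: MochizukiFrdI2008, §0 p.17] -/
def IsMidAdjoint (S : MorphismProperty C) {A B : C} (φ : A ⟶ B) : Prop :=
  ∀ ⦃X Y : C⦄ (γ : A ⟶ X) (β : X ⟶ Y) (α : Y ⟶ B), γ ≫ β ≫ α = φ → S β → IsIso β

/-- `β` is *subordinate* to `φ` if `φ = α ∘ β ∘ γ` for some `α`, `γ` (FrdI §0 p. 17).
[cite: MochizukiFrdI2008, §0 p.17] -/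
def IsSubordinate {X Y A B : C} (β : X ⟶ Y) (φ : A ⟶ B) : Prop :=
  ∃ (γ : A ⟶ X) (α : Y ⟶ B), γ ≫ β ≫ α = φ

/-- `φ` is *irreducible* if it is not an isomorphism but in every factorisation `φ = α ∘ β` one
of `α`, `β` is an isomorphism (FrdI §0 p. 17). [cite: MochizukiFrdI2008, §0 p.17] -/
def IsIrreducibleHom {A B : C} (φ : A ⟶ B) : Prop :=
  ¬ IsIso φ ∧ ∀ ⦃X : C⦄ (β : A ⟶ X) (α : X ⟶ B), β ≫ α = φ → IsIso α ∨ IsIso β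

/-- An *FSMI-morphism*: an irreducible FSM-morphism (FrdI §0 p. 17).
[cite: MochizukiFrdI2008, §0 p.17] -/
def IsFSMI {A B : C} (φ : A ⟶ B) : Prop := IsFSM φ ∧ IsIrreducibleHom φ

/-- "Thus, a category of FSM-type does not contain any FSMI-morphisms" (FrdI §0 p. 17).
[cite: MochizukiFrdI2008, §0 p.17] -/
theorem IsOfFSMType.not_isFSMI (hC : IsOfFSMType C) {A B : C} (φ : A ⟶ B) : ¬ IsFSMI φ :=
  fun h => h.2.1 (hC.isIso_of_isFSM φ h.1)

/-! ### Categories of FSMFF-type (pp. 17–18) -/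

/-- `IsFSMIChain φ n`: `φ` is a composite `φₙ ∘ ⋯ ∘ φ₁` of `n ≥ 1` FSMI-morphisms
(FrdI §0 pp. 17–18). [cite: MochizukiFrdI2008, §0 p.17] -/
inductive IsFSMIChain : ∀ {A B : C}, (A ⟶ B) → ℕ → Prop
  /-- a single FSMI-morphism is a chain of length one -/
  | single {A B : C} (φ : A ⟶ B) : IsFSMI φ → IsFSMIChain φ 1
  /-- prepending an FSMI-morphism to a chain -/
  | cons {A X B : C} (ψ : A ⟶ X) (χ : X ⟶ B) (n : ℕ) :
      IsFSMI ψ → IsFSMIChain χ n → IsFSMIChain (ψ ≫ χ) (n + 1)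

/-- A chain of FSMI-morphisms starts with an FSMI-morphism. [cite: MochizukiFrdI2008, §0 p.17] -/
theorem IsFSMIChain.exists_isFSMI {A B : C} {φ : A ⟶ B} {n : ℕ} (h : IsFSMIChain φ n) :
    ∃ (X : C) (ψ : A ⟶ X), IsFSMI ψ := by
  cases h with
  | single φ hφ => exact ⟨B, φ, hφ⟩
  | cons ψ χ n hψ _ => exact ⟨_, ψ, hψ⟩

/-- Chains have positive length. [cite: MochizukiFrdI2008, §0 p.17] -/
theorem IsFSMIChain.pos {A B : C} {φ : A ⟶ B} {n : ℕ} (h : IsFSMIChain φ n) : 0 < n := by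
  cases h with
  | single _ _ => exact Nat.one_pos
  | cons _ _ n _ _ => exact Nat.succ_pos n

variable (C) in
/-- `C` is *of FSMFF-type* ("FSM-finitely factorizable"): (a) every FSM-morphism that is not an
isomorphism factors as a composite of finitely many FSMI-morphisms; (b) for every object `A` the
lengths of composable chains of FSMI-morphisms starting at `A` are bounded (FrdI §0 pp. 17–18).
[cite: MochizukiFrdI2008, §0 p.17] -/
structure IsOfFSMFFType : Prop where
  /-- (a) finite factorisation of non-invertible FSM-morphisms into FSMI-morphisms -/
  factors : ∀ {A B : C} (φ : A ⟶ B), IsFSM φ → ¬ IsIso φ → ∃ n, IsFSMIChain φ n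
  /-- (b) bounded length of FSMI-chains out of each object -/
  bounded : ∀ A : C, ∃ N : ℕ, ∀ {B : C} (φ : A ⟶ B) (n : ℕ), IsFSMIChain φ n → n ≤ N

/-- "Thus, if `C` is of FSM-type, then it is of FSMFF-type" (FrdI §0 p. 18).
[cite: MochizukiFrdI2008, §0 p.18] -/
theorem IsOfFSMType.isOfFSMFFType (hC : IsOfFSMType C) : IsOfFSMFFType C where
  factors φ hφ hφ' := (hφ' (hC.isIso_of_isFSM φ hφ)).elim
  bounded A := ⟨0, fun φ n h => by
    obtain ⟨X, ψ, hψ⟩ := h.exists_isFSMI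
    exact (hC.not_isFSMI ψ hψ).elim⟩

/-- Iterated composites `φ ∘ ⋯ ∘ φ` of an endomorphism. [folklore] -/
private def iterComp {A : C} (φ : A ⟶ A) : ℕ → (A ⟶ A)
  | 0 => φ
  | n + 1 => φ ≫ iterComp φ n

/-- An FSMI endomorphism yields FSMI-chains of every length. [cite: MochizukiFrdI2008, §0 p.18] -/
private theorem isFSMIChain_iterComp {A : C} {φ : A ⟶ A} (hφ : IsFSMI φ) :
    ∀ n : ℕ, IsFSMIChain (iterComp φ n) (n + 1)
  | 0 => IsFSMIChain.single φ hφ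
  | n + 1 => IsFSMIChain.cons φ (iterComp φ n) (n + 1) hφ (isFSMIChain_iterComp hφ n)

/-- "We observe that [by condition (b)] no endomorphism of an object of a category of FSMFF-type is
an FSMI-morphism" (FrdI §0 p. 18). [cite: MochizukiFrdI2008, §0 p.18] -/
theorem IsOfFSMFFType.not_isFSMI_of_endomorphism (hC : IsOfFSMFFType C) {A : C} (φ : A ⟶ A) :
    ¬ IsFSMI φ := by
  intro hφ
  obtain ⟨N, hN⟩ := hC.bounded A
  have := hN (iterComp φ N) (N + 1) (isFSMIChain_iterComp hφ N)
  omega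

/-! ### Categorical quotients, anchors (p. 18) -/

/-- `φ : A → B` is a *categorical quotient of `A` by `G ⊆ Aut_C(A)`*: (a) `φ ∘ γ = φ` for all
`γ ∈ G`; (b) every `G`-invariant `ψ : A → C` factors uniquely through `φ` (FrdI §0 p. 18, stated
there for totally epimorphic `C`). [cite: MochizukiFrdI2008, §0 p.18] -/
def IsCategoricalQuotient {A B : C} (G : Subgroup (Aut A)) (φ : A ⟶ B) : Prop :=
  (∀ γ ∈ G, γ.hom ≫ φ = φ) ∧
    ∀ ⦃X : C⦄ (ψ : A ⟶ X), (∀ γ ∈ G, γ.hom ≫ ψ = ψ) → ∃! ψ' : B ⟶ X, φ ≫ ψ' = ψ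

/-- A categorical quotient `φ : A → B` of `A` by `G` is *mono-minimal* if every factorisation
`φ = φ' ∘ ζ` through a monomorphism `ζ : A → A'` carrying a compatible copy `G' ≅ G` of the group
action has `ζ` an isomorphism (FrdI §0 p. 18). [cite: MochizukiFrdI2008, §0 p.18] -/
def IsMonoMinimalQuotient {A B : C} (G : Subgroup (Aut A)) (φ : A ⟶ B) : Prop :=
  IsCategoricalQuotient G φ ∧
    ∀ ⦃A' : C⦄ (ζ : A ⟶ A') (φ' : A' ⟶ B), ζ ≫ φ' = φ → Mono ζ →
      (∃ (G' : Subgroup (Aut A')) (e : G ≃* G'),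
        ∀ γ : G, (γ : Aut A).hom ≫ ζ = ζ ≫ ((e γ : G') : Aut A').hom) → IsIso ζ

/-- "Thus, [by total epimorphicity] it follows that an isomorphism is always a mono-minimal
categorical quotient of its domain by the trivial group" (FrdI §0 p. 18).
[cite: MochizukiFrdI2008, §0 p.18] -/
theorem IsTotallyEpimorphic.isMonoMinimalQuotient_bot_of_isIso (hC : IsTotallyEpimorphic C)
    {A B : C} (φ : A ⟶ B) [IsIso φ] : IsMonoMinimalQuotient (⊥ : Subgroup (Aut A)) φ := by
  refine ⟨⟨fun γ hγ => ?_, fun X ψ _ => ?_⟩, fun A' ζ φ' hζ _ _ => ?_⟩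
  · rw [Subgroup.mem_bot] at hγ
    subst hγ
    exact Category.id_comp φ
  · refine ⟨inv φ ≫ ψ, by simp, fun ψ' hψ' => ?_⟩
    rw [← hψ', IsIso.inv_hom_id_assoc]
  · haveI : Epi ζ := hC.epi ζ
    haveI : IsSplitMono ζ := IsSplitMono.mk' ⟨φ' ≫ inv φ, by rw [← Category.assoc, hζ, IsIso.hom_inv_id]⟩
    exact isIso_of_epi_of_isSplitMono ζ

/-- `A` is an *anchor* if only finitely many isomorphism classes of objects of `^A C` arise from
irreducible arrows `A → B` (FrdI §0 p. 18). [cite: MochizukiFrdI2008, §0 p.18] -/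
def IsAnchor (A : C) : Prop :=
  Set.Finite {x : Quotient (isIsomorphicSetoid (Under A)) |
    ∃ f : Under A, IsIrreducibleHom f.hom ∧ Quotient.mk _ f = x}

/-- `A` is a *subanchor* if there is an arrow `A → B` to an anchor `B` (FrdI §0 p. 18).
[cite: MochizukiFrdI2008, §0 p.18] -/
def IsSubanchor (A : C) : Prop := ∃ B : C, IsAnchor B ∧ Nonempty (A ⟶ B)

/-- `A` is an *iso-subanchor* if some subanchor `B` admits a mono-minimal categorical quotient
`B → A` by a group of automorphisms `G ⊆ Aut_C(B)` (FrdI §0 p. 18, for totally epimorphic `C`).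
[cite: MochizukiFrdI2008, §0 p.18] -/
def IsIsoSubanchor (A : C) : Prop :=
  ∃ (B : C) (G : Subgroup (Aut B)) (f : B ⟶ A), IsSubanchor B ∧ IsMonoMinimalQuotient G f

end Categories

end Literature.AlgebraicGeometry.Frobenioids
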